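import Literature.AnabelianGeometry.AbsoluteAnabelian.AbsTopIII.FrobeniusPictureMLFLogLift
import Literature.AnabelianGeometry.AbsoluteAnabelian.AbsTopIII.FrobeniusPictureMLFCoresCompatible

/-!
# [AbsTopIII] Cor 3.6 (iii): the boundary set of the master family — pairs through the core vertices
# glued with the `𝔖_log` pairs into `𝒩` — is saturated

S. Mochizuki, *Topics in Absolute Anabelian Geometry III*, Cor. 3.6 (iii) pp. 80–81 of the kurims
manuscript (`paper:url-5493eb38cbb7`; bib key `MochizukiAbsTopIII2015`): `E_log` = the saturation of
the type-(1)/(2) pairs (proof of (iii), p. 81); §0 p. 26 (saturated sets).  Seat abc-iut-L4-t5 (gen 4),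
step 2 of the blueprint `HOME/staging/L4/L4-t5/DISCHARGE-PLAN-Cor36-compat.md` for `LogObsCompatCoresStmt`:
the boundary set of the family `K` on `𝒟` that is to realise the cores AND `𝔖_log` is
`GlueE := E_W ∪ E_log` — the pairs through a core vertex (rows 4–6; `univE coreVertices`,
`FrobeniusPictureMLFCoresCompatible`) together with the pairs INTO `𝒩` whose lifts to `𝒟_{≤3}`
(`liftLogPath`, `FrobeniusPictureMLFLogLift`) lie in the saturation of the `𝔖_log` generators
(`LogGen`).  This file proves that `GlueE` is SATURATED (`isSaturated_glueE`): the two parts do not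
interact under composition (no pair through rows 4–6 ends at `𝒩`: `not_univE_coreVertices_third`),
pre-composition preserves each part (`liftLogPath_comp`), and post-composing an `E_log` pair with a
non-trivial path out of `𝒩` lands in `E_W` through `ℰ` (`exists_eq_edge34_comp`).  Pure
combinatorics; no claim of the paper is asserted.
-/

namespace Literature.AnabelianGeometry.AbsoluteAnabelian

open _root_.CategoryTheory _root_.Quiver

universe u

namespace LogFrobeniusData

open DiagramOfCategories

variable (Δ : LogFrobeniusData.{u})

/-! ### Paths out of `𝒩` -/

/-- The only path `𝒩 → 𝒩` in `Γ⃗_𝒟` is the empty one (rows never decrease, and the edges into `𝒩` come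
from `□`). [cite: MochizukiAbsTopIII2015, Corollary 3.6 p.78] -/
theorem path_third_third_eq_nil (r : Path LFVertex.third LFVertex.third) : r = Path.nil := by
  cases r with
  | nil => rfl
  | cons r e =>
    rename_i c
    have h1 := LFVertex.row_le_of_path r
    have h2 := LFVertex.row_le_of_hom e
    revert h1 h2 e r
    cases c <;> intro r e h1 h2 <;> first | exact (PEmpty.elim e) | (simp only [LFVertex.row] at h1; omega)

/-- A path out of `𝒩` to another vertex starts with the edge `𝒩 → ℰ`.
[cite: MochizukiAbsTopIII2015, Corollary 3.6 p.78] -/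
theorem exists_eq_edge34_comp : ∀ {c : LFVertex} (r : Path LFVertex.third c), c ≠ LFVertex.third →
    ∃ s : Path LFVertex.fourth c, r = ((Path.nil : Path LFVertex.third LFVertex.third).cons LFVertex.edge34).comp s := by
  intro c r
  induction r with
  | nil => intro h; exact absurd rfl h
  | cons r e ih =>
    rename_i c' c
    intro _
    by_cases hc' : c' = LFVertex.third
    · subst hc'
      have hr := path_third_third_eq_nil r
      subst hr
      revert e
      cases c <;> intro e <;>
        first
          | exact (PEmpty.elim e)
          | exact ⟨Path.nil, by cases e; rfl⟩
    · obtain ⟨s, hs⟩ := ih hc'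
      exact ⟨s.cons e, by rw [hs, Path.comp_cons]⟩

/-! ### Lifting is compatible with composition -/

/-- `liftLogPath` of a composite path is the composite of the lifts.
[cite: MochizukiAbsTopIII2015, Corollary 3.6 (iii) p.80] -/
theorem liftLogPath_comp {a b : LFVertex} (P : Path a b) : ∀ {c : LFVertex} (Q : Path b c) (hc : c.row ≤ 3),
    liftLogPath.{u} (P.comp Q) hc =
      (liftLogPath P ((LFVertex.row_le_of_path Q).trans hc)).comp (liftLogPath Q hc) := by
  intro c Q
  induction Q with
  | nil => intro hc; rw [liftLogPath_nil]; rfl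
  | cons Q e ih =>
    intro hc
    rw [Path.comp_cons, liftLogPath_cons, liftLogPath_cons, Path.comp_cons, ih]

/-! ### The glued boundary set -/

/-- No pair THROUGH a core vertex (rows 4–6) ends at `𝒩` (rows never decrease).
[cite: MochizukiAbsTopIII2015, Corollary 3.6 p.78] -/
theorem not_univE_coreVertices_third {a : LFVertex} (P Q : Path a LFVertex.third) :
    ¬ univE coreVertices P Q := by
  rintro ⟨d⟩
  have h := LFVertex.row_le_of_path d.s
  rcases d.mem with hw | hw | hw <;> rw [hw] at h <;> simp only [LFVertex.row] at h <;> omega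

/-- **The boundary set of the master family**: the pairs through a core vertex of rows 4–6 (`E_W`,
boundary set of the universal family over `ℰ`) together with the pairs into `𝒩` whose lifts to `𝒟_{≤3}`
lie in the saturation `E_log` of the `𝔖_log` generators (type (1)/(2) pairs, proof of (iii) p. 81).
[cite: MochizukiAbsTopIII2015, Corollary 3.6 (iii) p.81] -/
inductive GlueE : ∀ ⦃a b : LFVertex⦄, Path a b → Path a b → Prop
  | univ {a b : LFVertex} {P Q : Path a b} : univE coreVertices P Q → GlueE P Q
  | log {a : LFVertex} {P Q : Path a LFVertex.third} :
      Saturation Δ.LogGen (liftLogPath.{u} P le_rfl) (liftLogPath.{u} Q le_rfl) → GlueE P Q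

/-- An `E_log` pair post-composed with a path out of `𝒩` is again in the glued set: trivially if the
path is empty, through `ℰ` (an `E_W` pair) otherwise. [cite: MochizukiAbsTopIII2015, Corollary 3.6 (iii) p.81] -/
theorem glueE_postcomp_log {a : LFVertex} {P Q : Path a LFVertex.third}
    (h : Saturation Δ.LogGen (liftLogPath.{u} P le_rfl) (liftLogPath.{u} Q le_rfl)) :
    ∀ {c : LFVertex} (r : Path LFVertex.third c), Δ.GlueE (P.comp r) (Q.comp r) := by
  intro c r
  by_cases hc : c = LFVertex.third
  · subst hc
    rw [path_third_third_eq_nil r, Path.comp_nil, Path.comp_nil]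
    exact GlueE.log h
  · obtain ⟨s, rfl⟩ := exists_eq_edge34_comp r hc
    refine GlueE.univ ⟨⟨LFVertex.fourth, Or.inl rfl, P.cons LFVertex.edge34, Q.cons LFVertex.edge34, s,
      ?_, ?_⟩⟩
    · rw [← Path.comp_assoc]; rfl
    · rw [← Path.comp_assoc]; rfl

/-- **The glued boundary set is saturated** (§0 p. 26 (a)–(e)): the two parts are each saturated and
they do not mix under composition. [cite: MochizukiAbsTopIII2015, Section 0 p.26] -/
theorem isSaturated_glueE : IsSaturated Δ.GlueE where
  refl_left := by
    intro a b P Q h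
    cases h with
    | univ h => exact GlueE.univ ((isSaturated_univE coreVertices).refl_left h)
    | log h => exact GlueE.log h.refl_left
  refl_right := by
    intro a b P Q h
    cases h with
    | univ h => exact GlueE.univ ((isSaturated_univE coreVertices).refl_right h)
    | log h => exact GlueE.log h.refl_right
  trans := by
    intro a b P Q R h₁ h₂
    cases h₁ with
    | univ h₁ =>
      cases h₂ with
      | univ h₂ => exact GlueE.univ ((isSaturated_univE coreVertices).trans h₁ h₂)
      | log h₂ => exact absurd h₁ (not_univE_coreVertices_third _ _)
    | log h₁ =>
      cases h₂ with
      | univ h₂ => exact absurd h₂ (not_univE_coreVertices_third _ _)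
      | log h₂ => exact GlueE.log (h₁.trans h₂)
  precomp := by
    intro a b c P Q h r
    cases h with
    | univ h => exact GlueE.univ ((isSaturated_univE coreVertices).precomp h r)
    | log h =>
      refine GlueE.log ?_
      rw [liftLogPath_comp, liftLogPath_comp]
      exact h.precomp _
  postcomp := by
    intro a b c P Q h r
    cases h with
    | univ h => exact GlueE.univ ((isSaturated_univE coreVertices).postcomp h r)
    | log h => exact Δ.glueE_postcomp_log h r

/-- `E_log` pairs are glued pairs. [cite: MochizukiAbsTopIII2015, Corollary 3.6 (iii) p.81] -/
theorem glueE_of_log {a : LFVertex} {P Q : Path a LFVertex.third}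
    (h : Saturation Δ.LogGen (liftLogPath.{u} P le_rfl) (liftLogPath.{u} Q le_rfl)) : Δ.GlueE P Q :=
  GlueE.log h

/-- `E_W` pairs are glued pairs. [cite: MochizukiAbsTopIII2015, Corollary 3.6 (i) p.80] -/
theorem glueE_of_univE {a b : LFVertex} {P Q : Path a b} (h : univE coreVertices P Q) : Δ.GlueE P Q :=
  GlueE.univ h

/-- A glued pair into `𝒩` is an `E_log` pair. [cite: MochizukiAbsTopIII2015, Corollary 3.6 (iii) p.81] -/
theorem saturation_of_glueE_third {a : LFVertex} {P Q : Path a LFVertex.third} (h : Δ.GlueE P Q) :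
    Saturation Δ.LogGen (liftLogPath.{u} P le_rfl) (liftLogPath.{u} Q le_rfl) := by
  cases h with
  | univ h => exact absurd h (not_univE_coreVertices_third P Q)
  | log h => exact h

/-- Every co-verticial pair into a core vertex is a glued pair.
[cite: MochizukiAbsTopIII2015, Corollary 3.6 (i) p.80] -/
theorem glueE_of_coreVertices {a w : LFVertex} (hw : coreVertices w) (P Q : Path a w) : Δ.GlueE P Q :=
  GlueE.univ (univE_of_mem coreVertices hw P Q)

end LogFrobeniusData

end Literature.AnabelianGeometry.AbsoluteAnabelian
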